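import Literature.MathematicalPhysics.QuantumFieldTheory.ConformalBootstrap3D.PointKernelK34v2Data
import Literature.MathematicalPhysics.QuantumFieldTheory.ConformalBootstrap3D.PointKernelParts

/-!
# K34v2 certificate, kernel part file P48: one-cell head segments 154, 155 in level ranges

The head cells whose kernel evaluation exceeds one `decide` are one-cell segments of `hsegsK34v2`; each is
checked by `PCert.hPartSideOK` (side conditions) and `PCert.hPartOK` per level range `[n_lo, n_lo + count)`
against an integer claim, the claims summing to `≥ 0` (`PointKernel.partsOK`); soundness is
`PCert.hParts_sound` (`PointKernelParts`).  The part files `P1, P2, …` are mutually independent (each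
imports only the data file); the ranges of one cell may span several of them, and the per-cell
conclusions `hparts_i` / `hcell_i` of those cells are assembled in `PointKernelK34v2.lean`.
Estimated kernel time 240 s.
-/

set_option maxRecDepth 100000
set_option maxHeartbeats 0

namespace Literature.MathematicalPhysics.QuantumFieldTheory.ConformalBootstrap3D.PointKernelK34v2

open Literature.MathematicalPhysics.QuantumFieldTheory.ConformalBootstrap3D.PointKernel

/-- levels `[56, 61)` of segment 154: partial lower sum `≥` claim. [folklore] -/
theorem part_154_4 : certK34v2.hPartOK (PCert.segAt hsegsK34v2 154) JHK34v2 56 5 (726152202676371408866402980920331435) = true := by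
  decide +kernel

/-- levels `[61, 65)` of segment 154: partial lower sum `≥` claim. [folklore] -/
theorem part_154_5 : certK34v2.hPartOK (PCert.segAt hsegsK34v2 154) JHK34v2 61 4 (328191497499787639256980754451752851) = true := by
  decide +kernel

/-- one-cell segment 155 (row 6, cell `[897/128, 7177/1024]`, chord, `n_F = 64`,
6 level ranges): side conditions. [folklore] -/
theorem pside_155 : certK34v2.hPartSideOK (PCert.segAt hsegsK34v2 155) JHK34v2 = true := by
  decide +kernel

/-- its level ranges `(n_lo, count, claim)`. [folklore] -/
def parts_155 : List (ℕ × ℕ × ℤ) := [(0, 28, -32857167048187764371700379975629889637), (28, 12, 23437639774221461763818241375537868794), (40, 9, 6429788640952711511736314814669769165), (49, 7, 2027809921020434160292514088350270770), (56, 5, 680071572281797674118440317213938044), (61, 4, 281857139711359261734869379858042867)]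

/-- the ranges tile `[0, n_F]` and the claims sum to `≥ 0`. [folklore] -/
theorem pcov_155 : PointKernel.partsOK 64 parts_155 = true := by
  decide +kernel

/-- levels `[0, 28)` of segment 155: partial lower sum `≥` claim. [folklore] -/
theorem part_155_0 : certK34v2.hPartOK (PCert.segAt hsegsK34v2 155) JHK34v2 0 28 (-32857167048187764371700379975629889637) = true := by
  decide +kernel

/-- levels `[28, 40)` of segment 155: partial lower sum `≥` claim. [folklore] -/
theorem part_155_1 : certK34v2.hPartOK (PCert.segAt hsegsK34v2 155) JHK34v2 28 12 (23437639774221461763818241375537868794) = true := by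
  decide +kernel

end Literature.MathematicalPhysics.QuantumFieldTheory.ConformalBootstrap3D.PointKernelK34v2
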